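import Mathlib
import HarnessLib
import Literature.NumberTheory.LFunctions.ZetaScrew
import Literature.NumberTheory.LFunctions.WeilSmallSupportPositivity
import Literature.NumberTheory.LFunctions.UniformWeilPositivityRH
import Summits.RiemannHypothesis.RiemannHypothesis.Theorems.IntegerScrewWeilWindowCoerciveComb

/-!
# Route `IntegerScrew` — Bombieri's Theorem 12 in screw coordinates: an RH-FREE COERCIVE floor for
# Suzuki's kernel on zero-sum configurations of small diameter, growing like `log(1/diameter)`

Bombieri 2000, Thm. 12 is in the tree with an explicit constant (`Bombieri2000Thm12_symmetric`:
`(log(1/(2a)) − log⁺log(1/(2a)) − 8)·‖g‖₂² ≤ Re Q(g)` for test functions supported in `[−a, a]`,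
`0 < a`, `2a < log 2`).  Through the coercive comb transfer `sum_sum_zetaScrewKernel_ge_of_coercive`
(`IntegerScrewWeilWindowCoerciveComb`) it becomes a statement about finite configurations:

* `sum_sum_zetaScrewKernel_ge_bombieri` — for `0 < a`, `2a < log 2`, and every zero-sum real system
  `(sᵢ, wᵢ)` with `|sᵢ| < a`:
  **`(log(1/(2a)) − log⁺log(1/(2a)) − 8) · ∫_{[−a,a]} (Σ_{sᵢ<t} wᵢ)² dt ≤ Σᵢⱼ wᵢ wⱼ G(sᵢ, sⱼ)`**
  (when the constant is negative the bound follows from plain positivity, Yoshida's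
  `weilPositivityOn_of_le_log_two_half`).

RH-FREE and EFFECTIVE: the coercivity constant is positive once `2a < e^{-8}/…` (roughly
`log(1/(2a)) > 10.3`), and grows like `log(1/(2a))` as the diameter shrinks — the `r → 1⁺` end of the
balanced window spectrum of the integer screw matrices (PIVOT-LAW §16.3 (a): `M·λ_min^{bal}` is LARGER at
ratio `1.004` than at ratio `1.5`) in theorem form, drawn for the integer windows in a sequel.  Nothing
here bears on the truth of RH.

References: E. Bombieri, Rend. Lincei (9) 11 (2000) §12 Thm. 12 [Bombieri2000Weil]; M. Suzuki, J. Lond.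
Math. Soc. (2) 108 (2023) = arXiv:2206.03682, Prop. 3.1 [Suzuki2023]; H. Yoshida (1992) Thm. 1.
-/

noncomputable section

-- D-0017: `Summit.<S>.<S>.…` is the designed namespace of a single-problem summit.
set_option linter.dupNamespace false

namespace Summit.RiemannHypothesis.RiemannHypothesis.Theorems.IntegerScrew

open Literature.NumberTheory.LFunctions MeasureTheory Set Finset
open Summit.RiemannHypothesis.RiemannHypothesis.Theorems.KernelOfWeilOn
  (sum_sum_zetaScrewKernel_nonneg_of_sum_eq_zero)

/-- **BOMBIERI'S THEOREM 12 ON CONFIGURATIONS** (RH-FREE, effective): for `0 < a` with `2a < log 2`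
and every zero-sum real system `(sᵢ, wᵢ)` at points `|sᵢ| < a`,
`(log(1/(2a)) − log⁺log(1/(2a)) − 8) · ∫_{[−a,a]} (Σ_{sᵢ<t} wᵢ)² dt ≤ Σᵢⱼ wᵢ wⱼ G(sᵢ, sⱼ)`.
[cite: Bombieri2000Weil, §12 Thm. 12] -/
theorem sum_sum_zetaScrewKernel_ge_bombieri {a : ℝ} (ha : 0 < a) (h2a : 2 * a < Real.log 2)
    {N : ℕ} (s w : Fin N → ℝ) (hs : ∀ i, |s i| < a) (hw : ∑ i, w i = 0) :
    (Real.log (1 / (2 * a)) - Real.posLog (Real.log (1 / (2 * a))) - 8) *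
        ∫ t in Icc (-a) a, (∑ i, if s i < t then w i else 0) ^ 2 ≤
      ∑ i, ∑ j, w i * w j * zetaScrewKernel (s i) (s j) := by
  set c : ℝ := Real.log (1 / (2 * a)) - Real.posLog (Real.log (1 / (2 * a))) - 8 with hc
  rcases le_or_gt 0 c with hc0 | hc0
  · -- coercive case: the comb transfer
    exact sum_sum_zetaScrewKernel_ge_of_coercive ha hc0
      (fun F hF hsupp => Bombieri2000Thm12_symmetric hF ha h2a hsupp) s w hs hw
  · -- `c < 0`: plain positivity below `(log 2)/2` (Yoshida)
    have hW : WeilPositivityOn a := weilPositivityOn_of_le_log_two_half (by linarith)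
    have hpos := sum_sum_zetaScrewKernel_nonneg_of_sum_eq_zero ha hW s w hs hw
    have hint : 0 ≤ ∫ t in Icc (-a) a, (∑ i, if s i < t then w i else 0) ^ 2 :=
      setIntegral_nonneg measurableSet_Icc fun t _ => sq_nonneg _
    nlinarith

end Summit.RiemannHypothesis.RiemannHypothesis.Theorems.IntegerScrew

end
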